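import Mathlib.Order.PiLex
import Mathlib.Data.Fintype.Perm
import Mathlib.Data.Fintype.Prod
import Mathlib.Data.Finset.Max
import Mathlib.Data.Fin.Rev
import Literature.InformationTheory.QuantumCodes.HypergraphProductKernels
import HarnessLib

/-!
# Double-lex normal form of a Boolean matrix under row permutations and block-preserving column permutations

LADDER-QEC (venture cell `qec`), type-10 lane, item 3 («DoubleLex») of qec-type-02's KERNEL-PLAN for the cell `(16, 1)` (census/type-02/css161/
KERNEL-PLAN.md): the symmetry-breaking clauses `symClauses` of the SAT encoding `Census/CSSNormalFormSAT/Encode.lean` (p550403) assume the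
`b × m` matrix `P` in DOUBLE-LEX NORMAL FORM — rows nondecreasing as binary integers (bit `m − 1` most significant) and, inside each of the
two column blocks `[0, w)` and `[w, m)`, `col_{j+1} ≤_lex col_j` (row `0` most significant). THIS FILE proves that this is WITHOUT LOSS OF
GENERALITY: every `P : Fin b → Fin m → Bool` has, in its orbit under (row permutations) × (column permutations preserving the blocks), a
representative in double-lex normal form (`exists_doubleLex`). PROOF (the standard orbit-minimum argument): order matrices by the row-major
lexicographic key (`Pi.Lex` of `Pi.Lex`, row `0` first, inside a row bit `m − 1` first); a key-MINIMAL element of the (finite) orbit has sorted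
rows — otherwise swapping an adjacent inverted pair of rows lowers the key (Mathlib `Pi.lex_desc`) — and block-sorted columns — otherwise, at the
first row where two adjacent same-block columns differ the more significant one carries the `1`, and swapping the two columns lowers that row
(again `Pi.lex_desc`) while leaving all earlier rows unchanged. The sortedness predicates are stated in the FIRST-DIFFERENCE form that the lex
clause chains encode (`RowSorted`, `ColSorted`). Companion (`normalForm_relabel`): the `k = 1` normal-form conditions `(Z)`, `(X)` of
`Census/CSSNormalFormK1.lean` transport along any relabelling `(A.submatrix e_κ e_μ, s ∘ e_μ)` — so passing to the double-lex representative (with a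
block-preserving `e_μ` and block-constant `s`, `s ∘ e_μ = s`) loses nothing; and `exists_equiv_sort`: a relabelling `Fin m ≃ μ` making
`supp s` the initial block `[0, wt s)` (the SAT encoding's `s = 1^w 0^{m−w}`). No SAT, no `decide`; axioms standard. [folklore] (lex-leader symmetry breaking; e.g. Crawford–
Ginsberg–Luks–Roy, KR 1996, «Symmetry-breaking predicates for search problems», §3 — cited for context only, nothing is taken from print).
-/

namespace Summit.Ventures.QEC.Census.DoubleLex

open Finset

variable {b m : ℕ}

/-- Relabelling rows by `σ` and columns by `τ`. [folklore] -/
def relabel (P : Fin b → Fin m → Bool) (σ : Equiv.Perm (Fin b)) (τ : Equiv.Perm (Fin m)) : Fin b → Fin m → Bool :=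
  fun i j => P (σ i) (τ j)

/-- `τ` preserves the column blocks `[0, w)` and `[w, m)`. (A predicate with parameters, ours — not a named fact.) [folklore] -/
structure BlockPres (w : ℕ) (τ : Equiv.Perm (Fin m)) : Prop where
  /-- every column stays in its block -/
  out : ∀ j : Fin m, ((τ j : ℕ) < w ↔ (j : ℕ) < w)

/-- Rows nondecreasing as binary integers, bit `m − 1` most significant, in first-difference form: for adjacent rows `i, i+1` and every column
`j` such that the two rows agree on all columns `> j`, `P i j ≤ P (i+1) j`. (A predicate with parameters, ours.) [folklore] -/
structure RowSorted (P : Fin b → Fin m → Bool) : Prop where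
  /-- adjacent rows compare `≤` at the first (most significant) difference -/
  out : ∀ i i' : Fin b, (i' : ℕ) = i + 1 → ∀ j : Fin m, (∀ j' : Fin m, j < j' → P i j' = P i' j') → P i j = true → P i' j = true

/-- Inside each block, `col_{j+1} ≤_lex col_j` with row `0` most significant, in first-difference form: for adjacent same-block columns `j, j+1`
and every row `i` such that the two columns agree on all rows `< i`, `P i (j+1) ≤ P i j`. (A predicate with parameters, ours.) [folklore] -/
structure ColSorted (w : ℕ) (P : Fin b → Fin m → Bool) : Prop where
  /-- adjacent same-block columns compare `≥` at the first (topmost) difference -/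
  out : ∀ j j' : Fin m, (j' : ℕ) = j + 1 → (((j : ℕ) < w ↔ (j' : ℕ) < w)) →
    ∀ i : Fin b, (∀ i' : Fin b, i' < i → P i' j = P i' j') → P i j' = true → P i j = true

/-- The row-major lexicographic key (row `0` first; inside a row the columns in decreasing order). [folklore] -/
def key (P : Fin b → Fin m → Bool) : Lex (Fin b → Lex (Fin m → Bool)) :=
  toLex fun i => toLex fun k => P i (Fin.rev k)

/-- A row read from the most significant bit. [folklore] -/
def rowR (P : Fin b → Fin m → Bool) (i : Fin b) : Fin m → Bool := fun k => P i (Fin.rev k)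

/-- Unfolding the key order: first differing row, compared as reversed-column lex. [folklore] -/
theorem key_lt_iff (P Q : Fin b → Fin m → Bool) :
    key P < key Q ↔ ∃ i, (∀ i', i' < i → toLex (rowR P i') = toLex (rowR Q i')) ∧ toLex (rowR P i) < toLex (rowR Q i) :=
  Iff.rfl

/-- Unfolding the row order: first differing (most significant) position. [folklore] -/
theorem rowR_lt_iff (x y : Fin m → Bool) :
    toLex x < toLex y ↔ ∃ k, (∀ k', k' < k → x k' = y k') ∧ x k < y k :=
  Iff.rfl

/-- **Double-lex normal form is w.l.o.g.**: every Boolean matrix has a row permutation and a block-preserving column permutation putting it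
in double-lex normal form. [folklore] -/
theorem exists_doubleLex (P : Fin b → Fin m → Bool) (w : ℕ) :
    ∃ σ : Equiv.Perm (Fin b), ∃ τ : Equiv.Perm (Fin m),
      BlockPres w τ ∧ RowSorted (relabel P σ τ) ∧ ColSorted w (relabel P σ τ) := by
  classical
  let G : Finset (Equiv.Perm (Fin b) × Equiv.Perm (Fin m)) :=
    univ.filter fun g => ∀ j : Fin m, ((g.2 j : ℕ) < w ↔ (j : ℕ) < w)
  have hG1 : ((1 : Equiv.Perm (Fin b)), (1 : Equiv.Perm (Fin m))) ∈ G := by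
    simp [G]
  obtain ⟨g, hg, hmin⟩ := G.exists_min_image (fun g => key (relabel P g.1 g.2)) ⟨_, hG1⟩
  have hgB : ∀ j : Fin m, ((g.2 j : ℕ) < w ↔ (j : ℕ) < w) := (Finset.mem_filter.mp hg).2
  set Q := relabel P g.1 g.2 with hQ
  refine ⟨g.1, g.2, ⟨hgB⟩, ⟨?_⟩, ⟨?_⟩⟩
  · -- rows
    intro i i' hi' j hagree hij
    by_contra hi'j
    have hi'j' : Q i' j = false := by simpa using hi'j
    -- swapping rows i, i' lowers the key
    let g' : Equiv.Perm (Fin b) × Equiv.Perm (Fin m) := (g.1 * Equiv.swap i i', g.2)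
    have hg' : g' ∈ G := by simp [G, g', hgB]
    have hrel : relabel P g'.1 g'.2 = fun x => Q (Equiv.swap i i' x) := by
      funext x y
      simp [g', relabel, hQ, Equiv.Perm.mul_apply]
    have hlt : key (relabel P g'.1 g'.2) < key Q := by
      rw [hrel]
      have hii' : i ≤ i' := by
        rw [Fin.le_iff_val_le_val]; omega
      have hrow : toLex (rowR Q i') < toLex (rowR Q i) := by
        rw [rowR_lt_iff]
        refine ⟨Fin.rev j, fun k hk => ?_, ?_⟩
        · have hjk : j < Fin.rev k := by
            rw [Fin.lt_def] at hk ⊢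
            rw [Fin.val_rev] at hk ⊢
            omega
          exact (hagree (Fin.rev k) hjk).symm
        · have h1 : rowR Q i' (Fin.rev j) = false := by rw [rowR, Fin.rev_rev]; exact hi'j'
          have h2 : rowR Q i (Fin.rev j) = true := by rw [rowR, Fin.rev_rev]; exact hij
          rw [h1, h2]
          decide
      have h := Pi.lex_desc (f := fun x => toLex (rowR Q x)) hii' hrow
      -- `key (fun x => Q (swap i i' x)) = toLex ((fun x => toLex (rowR Q x)) ∘ swap i i')`
      exact h
    exact absurd (hmin g' hg') (not_le.mpr hlt)
  · -- columns
    intro j j' hj' hblock i hagree hij'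
    by_contra hij
    have hijf : Q i j = false := by simpa using hij
    let g' : Equiv.Perm (Fin b) × Equiv.Perm (Fin m) := (g.1, g.2 * Equiv.swap j j')
    have hg' : g' ∈ G := by
      simp only [G, g', Finset.mem_filter, Finset.mem_univ, true_and]
      intro y
      rw [Equiv.Perm.mul_apply, hgB]
      rcases eq_or_ne y j with rfl | hyj
      · rw [Equiv.swap_apply_left]; exact hblock.symm
      rcases eq_or_ne y j' with rfl | hyj'
      · rw [Equiv.swap_apply_right]; exact hblock
      rw [Equiv.swap_apply_of_ne_of_ne hyj hyj']
    have hrel : relabel P g'.1 g'.2 = fun x y => Q x (Equiv.swap j j' y) := by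
      funext x y
      simp [g', relabel, hQ, Equiv.Perm.mul_apply]
    have hlt : key (relabel P g'.1 g'.2) < key Q := by
      rw [hrel, key_lt_iff]
      refine ⟨i, fun x hx => ?_, ?_⟩
      · refine congrArg toLex (funext fun k => ?_)
        simp only [rowR]
        rcases eq_or_ne (Fin.rev k) j with h | h
        · rw [h, Equiv.swap_apply_left]; exact (hagree x hx).symm
        rcases eq_or_ne (Fin.rev k) j' with h' | h'
        · rw [h', Equiv.swap_apply_right]; exact hagree x hx
        rw [Equiv.swap_apply_of_ne_of_ne h h']
      · have hjj' : Fin.rev j' ≤ Fin.rev j := by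
          rw [Fin.le_iff_val_le_val, Fin.val_rev, Fin.val_rev]; omega
        have hval : rowR Q i (Fin.rev j) < rowR Q i (Fin.rev j') := by
          have h1 : rowR Q i (Fin.rev j) = false := by rw [rowR, Fin.rev_rev]; exact hijf
          have h2 : rowR Q i (Fin.rev j') = true := by rw [rowR, Fin.rev_rev]; exact hij'
          rw [h1, h2]
          decide
        have h := Pi.lex_desc (f := rowR Q i) hjj' hval
        have hfun : (fun k => Q i (Equiv.swap j j' (Fin.rev k))) = rowR Q i ∘ Equiv.swap (Fin.rev j') (Fin.rev j) := by
          funext k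
          simp only [Function.comp, rowR]
          congr 1
          rcases eq_or_ne k (Fin.rev j') with h1 | h1
          · subst h1; rw [Equiv.swap_apply_left, Fin.rev_rev, Fin.rev_rev, Equiv.swap_apply_right]
          rcases eq_or_ne k (Fin.rev j) with h2 | h2
          · subst h2; rw [Equiv.swap_apply_right, Fin.rev_rev, Fin.rev_rev, Equiv.swap_apply_left]
          have h1' : Fin.rev k ≠ j' := fun h => h1 (by rw [← h, Fin.rev_rev])
          have h2' : Fin.rev k ≠ j := fun h => h2 (by rw [← h, Fin.rev_rev])
          rw [Equiv.swap_apply_of_ne_of_ne h1 h2, Equiv.swap_apply_of_ne_of_ne h2' h1']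
        show toLex (fun k => Q i (Equiv.swap j j' (Fin.rev k))) < toLex (rowR Q i)
        rw [hfun]
        exact h
    exact absurd (hmin g' hg') (not_le.mpr hlt)

/-! ## Transport of the `k = 1` normal-form conditions along a relabelling -/

section Relabel

open Matrix Literature.InformationTheory.QuantumCodes

variable {κ μ κ' μ' : Type*} [Fintype κ] [Fintype μ] [Fintype κ'] [Fintype μ']

/-- **`(Z)`, `(X)` are invariant under relabelling rows and columns**: if `(A, s)` satisfies the `k = 1` normal-form conditions at distance `d`
then so does `(A.submatrix e_κ e_μ, s ∘ e_μ)` for any bijections `e_κ`, `e_μ`. [folklore] -/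
theorem normalForm_relabel (A : Matrix κ μ (ZMod 2)) (s : μ → ZMod 2) (d : ℕ) (eκ : κ' ≃ κ) (eμ : μ' ≃ μ)
    (hZ : ∀ v : κ → ZMod 2, d ≤ hammingNorm v + hammingNorm (v ᵥ* A + s))
    (hX : ∀ u : μ → ZMod 2, u ⬝ᵥ s = 1 → d ≤ hammingNorm u + hammingNorm (A *ᵥ u)) :
    (∀ v : κ' → ZMod 2, d ≤ hammingNorm v + hammingNorm (v ᵥ* A.submatrix eκ eμ + s ∘ eμ)) ∧
      (∀ u : μ' → ZMod 2, u ⬝ᵥ (s ∘ eμ) = 1 → d ≤ hammingNorm u + hammingNorm (A.submatrix eκ eμ *ᵥ u)) := by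
  refine ⟨fun v => ?_, fun u hu => ?_⟩
  · have h := hZ (v ∘ eκ.symm)
    have e1 : v ᵥ* A.submatrix eκ eμ + s ∘ eμ = ((v ∘ eκ.symm) ᵥ* A + s) ∘ eμ := by
      rw [submatrix_vecMul_equiv]; rfl
    have hn1 : hammingNorm (((v ∘ eκ.symm) ᵥ* A + s) ∘ eμ) = hammingNorm ((v ∘ eκ.symm) ᵥ* A + s) := by
      simpa using hammingNorm_comp_equiv ((v ∘ eκ.symm) ᵥ* A + s) eμ.symm
    have hn2 : hammingNorm v = hammingNorm (v ∘ eκ.symm) := (hammingNorm_comp_equiv v eκ).symm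
    rw [e1, hn1, hn2]
    exact h
  · have hu' : (u ∘ eμ.symm) ⬝ᵥ s = 1 := by rwa [comp_equiv_symm_dotProduct]
    have h := hX (u ∘ eμ.symm) hu'
    have e1 : A.submatrix eκ eμ *ᵥ u = (A *ᵥ (u ∘ eμ.symm)) ∘ eκ := submatrix_mulVec_equiv _ _ _ _
    have hn1 : hammingNorm ((A *ᵥ (u ∘ eμ.symm)) ∘ eκ) = hammingNorm (A *ᵥ (u ∘ eμ.symm)) := by
      simpa using hammingNorm_comp_equiv (A *ᵥ (u ∘ eμ.symm)) eκ.symm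
    have hn2 : hammingNorm u = hammingNorm (u ∘ eμ.symm) := (hammingNorm_comp_equiv u eμ).symm
    rw [e1, hn1, hn2]
    exact h

end Relabel

/-! ## Sorting the translate: a relabelling `Fin m ≃ μ` under which `supp s` becomes the initial block `[0, wt s)` -/

section SortTranslate

open Literature.InformationTheory.QuantumCodes

variable {μ : Type*} [Fintype μ] [DecidableEq μ]

/-- **The translate can be sorted**: for `s : μ → 𝔽₂` and `|μ| = m` there is a bijection `e : Fin m ≃ μ` with `s (e k) ≠ 0 ↔ k < wt s`,
i.e. `s ∘ e = 1^{wt s} 0^{m − wt s}`. (Use with `normalForm_relabel`.) [folklore] -/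
theorem exists_equiv_sort (s : μ → ZMod 2) {m : ℕ} (hm : Fintype.card μ = m) :
    ∃ e : Fin m ≃ μ, ∀ k : Fin m, s (e k) ≠ 0 ↔ (k : ℕ) < hammingNorm s := by
  classical
  set S : Finset μ := univ.filter fun q => s q ≠ 0 with hS
  have hw : #S = hammingNorm s := rfl
  have hwm : hammingNorm s ≤ m := by
    rw [← hw, ← hm]; exact (card_filter_le _ _).trans (card_univ (α := μ)).le
  -- `Fin (wt s) ≃ S`, `Fin (m - wt s) ≃ Sᶜ`
  have hcS : Fintype.card {q // q ∈ S} = hammingNorm s := by rw [Fintype.card_coe, hw]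
  have hcC : Fintype.card {q // q ∉ S} = m - hammingNorm s := by
    rw [Fintype.card_subtype_compl, Fintype.card_coe, hw, hm]
  let eS : Fin (hammingNorm s) ≃ {q // q ∈ S} := (Fintype.equivFinOfCardEq hcS).symm
  let eC : Fin (m - hammingNorm s) ≃ {q // q ∉ S} := (Fintype.equivFinOfCardEq hcC).symm
  let e : Fin m ≃ μ :=
    ((finCongr (by omega : m = hammingNorm s + (m - hammingNorm s))).trans finSumFinEquiv.symm).trans
      ((eS.sumCongr eC).trans (Equiv.sumCompl fun q => q ∈ S))
  refine ⟨e, fun k => ?_⟩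
  have hmemS : ∀ q : μ, q ∈ S ↔ s q ≠ 0 := fun q => by rw [hS, Finset.mem_filter]; simp
  rw [← hmemS]
  by_cases hk : (k : ℕ) < hammingNorm s
  · -- lands in `S`
    have hcast : finSumFinEquiv.symm (finCongr (by omega : m = hammingNorm s + (m - hammingNorm s)) k) =
        Sum.inl ⟨k, hk⟩ := by
      rw [Equiv.symm_apply_eq]
      ext; simp
    simp only [e, Equiv.trans_apply, hcast, Equiv.sumCongr_apply, Sum.map_inl, Equiv.sumCompl_apply_inl]
    exact iff_of_true (eS ⟨k, hk⟩).2 hk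
  · -- lands in `Sᶜ`
    have hk' : hammingNorm s ≤ (k : ℕ) := not_lt.mp hk
    have hlt : (k : ℕ) - hammingNorm s < m - hammingNorm s := by have := k.2; omega
    have hcast : finSumFinEquiv.symm (finCongr (by omega : m = hammingNorm s + (m - hammingNorm s)) k) =
        Sum.inr ⟨k - hammingNorm s, hlt⟩ := by
      rw [Equiv.symm_apply_eq]
      ext; simp; omega
    simp only [e, Equiv.trans_apply, hcast, Equiv.sumCongr_apply, Sum.map_inr, Equiv.sumCompl_apply_inr]
    exact iff_of_false (eC ⟨_, hlt⟩).2 hk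

end SortTranslate

end Summit.Ventures.QEC.Census.DoubleLex
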